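import Summits.CriticalPhenomena.PercolationContinuityZ3.Theorems.PercNearOneGluingAdditiveGluingThreePointTransfer
import HarnessLib

/-!
# Crux `PercNearOneGluing.AdditiveGluing` (stmt-CriticalPhenomena-4576), line `tieline`: the up-set transfer at `{c ∈ C_u}`

Support file (`--supports stmt-CriticalPhenomena-4576`, helper, lead c11).  No definitions, no named facts, no sorries.

Weighted graph on `Fin n` (`μ = prodBernoulli w`), relays `u, v`, observer `o`, spectator `c`; `D = {u ↮ v}`,
`N = {c ↮ u} ∩ {c ↮ v}` ("`c` free"), `K = C_u`, `L = C_v`, `P_D = P(· | u ↮ v)`, `π = P_D(o ↔ c | c free)`.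
The up-set transfer conjecture (UC) behind the registered kernel stub `stub_k0CovTransferQ_c9` asks, for an up-set
`𝒰` of the cluster `K`, that `P_D(o ∈ L) − P_D(o ∈ L | 𝒰) ≥ π · (P_D(c ∈ L) − P_D(c ∈ L | 𝒰))`.  Numerically its sharp
case is `𝒰 = {c ∈ K}` (where `P_D(c ∈ L | 𝒰) = 0`):

  (UC_c)  `P_D(o ∈ L) − P_D(o ∈ L | c ∈ K) ≥ π · P_D(c ∈ L)`,

proved here (`upsetTransfer_cInK`) in the division-free form
`μ(D ∩ N ∩ {o↔c}) · μ(D ∩ {v↔c}) · μ(D ∩ {u↔c}) ≤ μ(D ∩ N) · (μ(D ∩ {v↔o})·μ(D ∩ {u↔c}) − μ(D)·μ(D ∩ {v↔o} ∩ {u↔c}))`.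

Proof.  Under `D` the spectator is in exactly one of three positions, `D = (D ∩ {c ∈ L}) ⊔ (D ∩ {c ∈ K}) ⊔ (D ∩ N)`, so
`P_D(oL) − P_D(oL | cK) = P_D(cL)·[P_D(oL | cL) − P_D(oL | cK)] + P_D(N)·[P_D(oL | N) − P_D(oL | cK)]`, and
* the three-point transfer (3PT, `threePointTransfer`, already in the tree): `P_D(oL | cL) − P_D(oL | c ∉ L) ≥ π`;
* (X) van den Berg–Häggström–Kahn for the pair `(v, u)` with the one-sided guard `{v ↮ c}` (`guardedTwoClusterExchange`,
  `S = {v}`, `T = {u, c}`): on `D' = {v ↮ u} ∩ {v ↮ c} = D ∩ {c ∉ L}` the events `{v ↔ o}` (type `(+)`) and `{u ↔ c}`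
  (type `(−)`) are negatively correlated, `μ(D' ∩ vo ∩ uc)·μ(D') ≤ μ(D' ∩ vo)·μ(D' ∩ uc)`; as `P_D(oL | c ∉ L)` is a convex
  combination of `P_D(oL | cK)` and `P_D(oL | N)` this gives `P_D(oL | cK) ≤ P_D(oL | c ∉ L) ≤ P_D(oL | N)`;
then linear arithmetic: with `p̄ = μ(D ∩ {v ↮ c})`,
`p̄ · [slack of (UC_c)] = μ(D ∩ uc) · [slack of 3PT] + μ(D ∩ N)·μ(D) · [slack of (X)]`.
[cite: VandenbergHaggstromKahn2005, Thm. 1.3 (p. 6), Thm. 1.5 (p. 7), Thm. 2.1 (p. 9) with Remark 1 after Thm. 1.2 (p. 5)]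
[cite: KozmaNitzan2024, Lemma 4 (p. 9), Question 7 (p. 36)]
-/

namespace Summit.CriticalPhenomena.PercolationContinuityZ3.Cruxes.AdditiveGluing.TieLine

open MeasureTheory Set Literature.Probability.LatticeModels Literature.Probability.Percolation
open Summit.CriticalPhenomena.PercolationContinuityZ3.Theorems

noncomputable section

namespace UpsetTransferCInK

variable {n : ℕ}

/-- **(X)** Guarded BHK for `S = {v}`, `T = {u,c}`, pair `(v,u)`: `{v↔o}` is of type `(+)` and `{u↔c}` of type `(−)`,
so `μ({v↮u,v↮c} ∩ (v↔o ∩ u↔c)) · μ({v↮u,v↮c}) ≤ μ({v↮u,v↮c} ∩ v↔o) · μ({v↮u,v↮c} ∩ u↔c)`.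
[cite: VandenbergHaggstromKahn2005, Thm. 1.3 (p. 6), Thm. 2.1 (p. 9) at q = 1] -/
theorem stepX (w : Sym2 (Fin n) → unitInterval) (o u v c : Fin n) :
    (prodBernoulli w).real ((openConn v u)ᶜ ∩ (openConn v c)ᶜ ∩ (openConn v o ∩ openConn u c)) *
        (prodBernoulli w).real ((openConn v u)ᶜ ∩ (openConn v c)ᶜ : Set (BondConfig (Fin n))) ≤
      (prodBernoulli w).real ((openConn v u)ᶜ ∩ (openConn v c)ᶜ ∩ openConn v o) *
        (prodBernoulli w).real ((openConn v u)ᶜ ∩ (openConn v c)ᶜ ∩ openConn u c) := by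
  have key := guardedTwoClusterExchange w ({v} : Set (Fin n)) ({u, c} : Set (Fin n)) (s := v) (t := u)
    (by simp) (by simp)
    (A₁ := openConn v o) (A₂ := univ) (B₁ := openConn u c) (B₂ := univ)
    (typePlus_openConn v u o) (fun _ _ _ _ _ => mem_univ _) (typeMinus_openConn v u c)
    (fun _ _ _ _ _ => mem_univ _)
  simpa only [ThreePointTransfer.sep_v_uc_eq, inter_univ, univ_inter] using key

/-- `{v↮u} ∩ {v↮c} ∩ {u↔c} = D ∩ {u↔c}` (`u ↔ c` and `u ↮ v` force `v ↮ c`). [folklore] -/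
theorem X_uc_eq (u v c : Fin n) :
    ((openConn v u)ᶜ ∩ (openConn v c)ᶜ ∩ openConn u c : Set (BondConfig (Fin n))) = (openConn u v)ᶜ ∩ openConn u c := by
  ext ω
  simp only [mem_inter_iff, mem_compl_iff, openConn, mem_setOf_eq]
  constructor
  · rintro ⟨⟨hvu, -⟩, huc⟩
    exact ⟨fun huv => hvu huv.symm, huc⟩
  · rintro ⟨huv, huc⟩
    exact ⟨⟨fun hvu => huv hvu.symm, fun hvc => huv (huc.trans hvc.symm)⟩, huc⟩

/-- `{v↮u} ∩ {v↮c} ∩ ({v↔o} ∩ {u↔c}) = D ∩ {v↔o} ∩ {u↔c}`. [folklore] -/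
theorem X_vo_uc_eq (o u v c : Fin n) :
    ((openConn v u)ᶜ ∩ (openConn v c)ᶜ ∩ (openConn v o ∩ openConn u c) : Set (BondConfig (Fin n))) =
      (openConn u v)ᶜ ∩ openConn v o ∩ openConn u c := by
  ext ω
  simp only [mem_inter_iff, mem_compl_iff, openConn, mem_setOf_eq]
  constructor
  · rintro ⟨⟨hvu, -⟩, hvo, huc⟩
    exact ⟨⟨fun huv => hvu huv.symm, hvo⟩, huc⟩
  · rintro ⟨⟨huv, hvo⟩, huc⟩
    exact ⟨⟨fun hvu => huv hvu.symm, fun hvc => huv (huc.trans hvc.symm)⟩, hvo, huc⟩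

/-- `D ∩ {u↔c} ⊆ D ∩ {v↮c}` (under `u ↮ v`, `c ∈ C_u` forces `c ∉ C_v`). [folklore] -/
theorem D_uc_subset (u v c : Fin n) :
    ((openConn u v)ᶜ ∩ openConn u c : Set (BondConfig (Fin n))) ⊆ (openConn u v)ᶜ ∩ (openConn v c)ᶜ := by
  intro ω hω
  simp only [mem_inter_iff, mem_compl_iff, openConn, mem_setOf_eq] at hω ⊢
  exact ⟨hω.1, fun hvc => hω.1 (hω.2.trans hvc.symm)⟩

/-- `D ∩ {v↔o} ∩ {u↔c} ⊆ D ∩ {u↔c}`. [folklore] -/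
theorem D_vo_uc_subset (o u v c : Fin n) :
    ((openConn u v)ᶜ ∩ openConn v o ∩ openConn u c : Set (BondConfig (Fin n))) ⊆ (openConn u v)ᶜ ∩ openConn u c :=
  fun _ hω => ⟨hω.1.1, hω.2⟩

end UpsetTransferCInK

open ThreePointTransfer UpsetTransferCInK in
/-- **Up-set transfer at the up-set `{c ∈ C_u}` (sharp case of (UC))** (line `tieline`, crux `AdditiveGluing`; lead c11):
with `D = {u ↮ v}`, `N = {c ↮ u} ∩ {c ↮ v}`,
`μ(D ∩ N ∩ {o↔c}) · μ(D ∩ {v↔c}) · μ(D ∩ {u↔c}) ≤ μ(D ∩ N) · (μ(D ∩ {v↔o})·μ(D ∩ {u↔c}) − μ(D)·μ(D ∩ {v↔o} ∩ {u↔c}))`,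
i.e. `P_D(o ∈ C_v) − P_D(o ∈ C_v | c ∈ C_u) ≥ P_D(o ↔ c | c free) · P_D(c ∈ C_v)`: the instance `𝒰 = {c ∈ C_u}` of the
up-set transfer conjecture behind the kernel stub `stub_k0CovTransferQ_c9`.  From the three-point transfer
`threePointTransfer`, one guarded BHK exchange (`UpsetTransferCInK.stepX`) and linear arithmetic
(`μ(D ∩ v↮c)·[slack] = μ(D ∩ uc)·[3PT slack] + μ(D ∩ N)μ(D)·[exchange slack]`).
[cite: VandenbergHaggstromKahn2005, Thm. 1.3 (p. 6), Thm. 1.5 (p. 7), Thm. 2.1 (p. 9)] [cite: KozmaNitzan2024, Question 7 (p. 36)] -/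
theorem upsetTransfer_cInK : ∀ (n : ℕ) (w : Sym2 (Fin n) → unitInterval) (o u v c : Fin n),
  (Literature.Probability.LatticeModels.prodBernoulli w).real ((Literature.Probability.Percolation.openConn u v)ᶜ ∩ ((Literature.Probability.Percolation.openConn c u)ᶜ ∩ (Literature.Probability.Percolation.openConn c v)ᶜ) ∩ Literature.Probability.Percolation.openConn o c) *
  ((Literature.Probability.LatticeModels.prodBernoulli w).real ((Literature.Probability.Percolation.openConn u v)ᶜ ∩ Literature.Probability.Percolation.openConn v c) *
   (Literature.Probability.LatticeModels.prodBernoulli w).real ((Literature.Probability.Percolation.openConn u v)ᶜ ∩ Literature.Probability.Percolation.openConn u c))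
  ≤ (Literature.Probability.LatticeModels.prodBernoulli w).real ((Literature.Probability.Percolation.openConn u v)ᶜ ∩ ((Literature.Probability.Percolation.openConn c u)ᶜ ∩ (Literature.Probability.Percolation.openConn c v)ᶜ) : Set (Literature.Probability.Percolation.BondConfig (Fin n))) *
  ((Literature.Probability.LatticeModels.prodBernoulli w).real ((Literature.Probability.Percolation.openConn u v)ᶜ ∩ Literature.Probability.Percolation.openConn v o) *
   (Literature.Probability.LatticeModels.prodBernoulli w).real ((Literature.Probability.Percolation.openConn u v)ᶜ ∩ Literature.Probability.Percolation.openConn u c) -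
   (Literature.Probability.LatticeModels.prodBernoulli w).real ((Literature.Probability.Percolation.openConn u v)ᶜ : Set (Literature.Probability.Percolation.BondConfig (Fin n))) *
   (Literature.Probability.LatticeModels.prodBernoulli w).real ((Literature.Probability.Percolation.openConn u v)ᶜ ∩ Literature.Probability.Percolation.openConn v o ∩ Literature.Probability.Percolation.openConn u c)) := by
  intro n w o u v c
  have h3 := threePointTransfer n w o u v c
  have hX := stepX w o u v c
  rw [X_vo_uc_eq o u v c, X_uc_eq u v c, II_left_eq o u v c, II_base_eq u v c] at hX
  obtain ⟨hD, hDo⟩ := real_D_split w o u v c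
  have hKle : (prodBernoulli w).real ((openConn u v)ᶜ ∩ openConn u c : Set (BondConfig (Fin n))) ≤
      (prodBernoulli w).real ((openConn u v)ᶜ ∩ (openConn v c)ᶜ : Set (BondConfig (Fin n))) :=
    measureReal_mono (D_uc_subset u v c)
  have hLoKle : (prodBernoulli w).real ((openConn u v)ᶜ ∩ openConn v o ∩ openConn u c : Set (BondConfig (Fin n))) ≤
      (prodBernoulli w).real ((openConn u v)ᶜ ∩ openConn u c : Set (BondConfig (Fin n))) :=
    measureReal_mono (D_vo_uc_subset o u v c)
  set μ := prodBernoulli w with hμ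
  set foc := μ.real ((openConn u v)ᶜ ∩ ((openConn c u)ᶜ ∩ (openConn c v)ᶜ) ∩ openConn o c : Set (BondConfig (Fin n)))
    with hfoc
  set f := μ.real ((openConn u v)ᶜ ∩ ((openConn c u)ᶜ ∩ (openConn c v)ᶜ) : Set (BondConfig (Fin n))) with hf
  set L₁ := μ.real ((openConn u v)ᶜ ∩ openConn v c : Set (BondConfig (Fin n))) with hL₁
  set K₁ := μ.real ((openConn u v)ᶜ ∩ openConn u c : Set (BondConfig (Fin n))) with hK₁
  set a := μ.real ((openConn u v)ᶜ : Set (BondConfig (Fin n))) with ha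
  set Lo := μ.real ((openConn u v)ᶜ ∩ openConn v o : Set (BondConfig (Fin n))) with hLo
  set LoK := μ.real ((openConn u v)ᶜ ∩ openConn v o ∩ openConn u c : Set (BondConfig (Fin n))) with hLoK
  set LoL := μ.real ((openConn u v)ᶜ ∩ openConn v o ∩ openConn v c : Set (BondConfig (Fin n))) with hLoL
  set pcb := μ.real ((openConn u v)ᶜ ∩ (openConn v c)ᶜ : Set (BondConfig (Fin n))) with hpcb
  set pocb := μ.real ((openConn u v)ᶜ ∩ (openConn v c)ᶜ ∩ openConn v o : Set (BondConfig (Fin n))) with hpocb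
  -- h3 : foc * (L₁ * pcb) ≤ f * (a * LoL - Lo * L₁);  hX : LoK * pcb ≤ pocb * K₁;  hD : a = L₁ + pcb;  hDo : Lo = LoL + pocb
  have hK0 : 0 ≤ K₁ := measureReal_nonneg
  have hf0 : 0 ≤ f := measureReal_nonneg
  have ha0 : 0 ≤ a := measureReal_nonneg
  have hLoK0 : 0 ≤ LoK := measureReal_nonneg
  rcases (measureReal_nonneg : 0 ≤ pcb).eq_or_lt with h0 | hpos
  · -- `μ(D ∩ v↮c) = 0`: then `μ(D ∩ uc) = μ(D ∩ vo ∩ uc) = 0` and both sides vanish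
    have hK : K₁ = 0 := le_antisymm (hKle.trans_eq h0.symm) hK0
    have hL : LoK = 0 := le_antisymm (hLoKle.trans_eq hK) hLoK0
    rw [hK, hL]
    simp
  · refine le_of_mul_le_mul_left ?_ hpos
    have hP : 0 ≤ K₁ * (f * (a * LoL - Lo * L₁) - foc * (L₁ * pcb)) := mul_nonneg hK0 (sub_nonneg.2 h3)
    have hQ : 0 ≤ f * a * (pocb * K₁ - LoK * pcb) := mul_nonneg (mul_nonneg hf0 ha0) (sub_nonneg.2 hX)
    have key : pcb * (f * (Lo * K₁ - a * LoK)) = pcb * (foc * (L₁ * K₁)) +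
        (K₁ * (f * (a * LoL - Lo * L₁) - foc * (L₁ * pcb)) + f * a * (pocb * K₁ - LoK * pcb)) := by
      rw [hD, hDo]; ring
    rw [key]
    linarith

end

end Summit.CriticalPhenomena.PercolationContinuityZ3.Cruxes.AdditiveGluing.TieLine
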